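import Summits.QuantumFields.BalabanUV.T4Continuum.Support.NE7DefectIterationCompact
import Summits.QuantumFields.BalabanUV.T4Continuum.Support.NE3EnergyShapes
import Mathlib.Analysis.SpecificLimits.Basic
import HarnessLib

/-!
# NE7DefectIterationCauchy — THE (S1) EXISTENCE ENGINE IN CAUCHY FORM (memo ROAD-G100 §2.5, second reading): a step that contracts the defect and DISPLACES THE STATE BY
# `≤ B·(defect)` has a geometric, hence convergent, orbit — the limit gauge exists WITHOUT compactness and WITHOUT continuity of the defect functional; only the pointwise
# closedness of unitarity∕periodicity is used (the consumer then needs continuity of the PRIMITIVE maps `u ↦ log(W⁻¹U′^{u})(b)` at the limit, never of the slice projection)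

Cell `pub-balaban`, rung (B)+1 sub-cell t4, lineage `b2b-balaban-t4-ne7-p1`, generation 100 (CRUX PROVER NE7 #1 = OWNER of BINDER row NE7).  Memo `t4/b2b-balaban-t4-ne7-p1-g100/ROAD-G100.md`
§2.3∕§2.5: the supplier (S1) iterates `u ↦ step u := e^{−ζ(u)}·u`; the letters give `Df(step u) ≤ θ·Df(u)`, `s(step u) ≤ s(u) + A·Df(u)` AND the size of the gauge function
`sup‖ζ(u)‖ ≤ 4dM·Df(u)` ((GF), `NE7SliceGaugeFunctionSized`), i.e. the state moves by `‖e^{−ζ(u)(x)}u(x) − u(x)‖ ≤ B·Df(u)`.  The compact engine `NE7DefectIterationCompact.exists_zero_defect`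
needs `Df` CONTINUOUS on the working region (the slice projection as a function of the state); THIS FILE removes that need: the orbit is Cauchy sitewise, converges to a unitary periodic
gauge `u_*`, with the orbit letters (`Df(u_j) ≤ θ^jδ₀`, `‖Φ(u_j)‖ ≤ s₀ + Aδ₀∕(1−θ)`) and the tail bound `‖u_j(x) − u_*(x)‖ ≤ Bδ₀θ^j∕(1−θ)` displayed — exactness of the slice condition at
`u_*` is then read by the consumer from the continuity of the primitive maps and the closedness of `𝒯_E(W)` under sitewise limits.
WHAT ([folklore]; 0 def, 0 sorry).
§1 ABSTRACT (any state type `α`, observation `ev : α → ι → F` into a complete normed group): `dist_orbit_succ_le` (the displacement along the orbit is `≤ Bδ₀·θ^j`);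
   **`exists_orbit_limit`**: `∃ v : ι → F`, `ev(u_j) i → v i` for every `i`, `dist (ev(u_j) i) (v i) ≤ Bδ₀θ^j∕(1−θ)`, and the orbit letters of `NE7DefectIterationCompact.iterate_invariant`.
§2 GAUGES (`α = Site d → (Matrix n n ℂ)ˣ`, `ev u x = u x`): `mem_unitary_of_tendsto`, `periodic_of_tendsto` (sitewise limits of unitary `P`-periodic gauges are unitary and `P`-periodic);
   **`exists_limit_gauge`**: the engine on the unitary `P`-periodic site gauges — `∃ u_*` unitary `P`-periodic with `u_j(x) → u_*(x)`, the tail bound and the orbit letters.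
HONEST FRAMING (page 1): elementary (geometric series in a complete space); discharges nothing of NE7 by itself; the one-step letters and the curved sup letter (L) are NOT here; NE7 NOT PROVED;
spine 0∕9; finite T⁴ rung (B)+1 — NOT infinite volume, NOT mass gap, NOT BetaPertH, NOT Clay.  Continuum YM on T⁴ ⇐ BetaPertH ∧ nine spine estimates (0/9 proved); BetaPertH ⇐ (D1) ∧ (D4) ∧
CAP+tail; G-an2-4 gates asym, D1 and NE2/3/4.
-/

set_option autoImplicit false

open Filter Topology Finset

namespace Summit.QuantumFields.BalabanUV.T4Continuum.NE7DefectIterationCauchy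

open NE7DefectIterationCompact (iterate_invariant iterate_norm_le)

/-! ## §1 The abstract Cauchy engine -/

section Engine

variable {α ι : Type*} {E : Type*} [SeminormedAddCommGroup E] {F : Type*} [NormedAddCommGroup F] [CompleteSpace F]
variable {K : Set α} {step : α → α} {Φ : α → E} {Df : α → ℝ} {ev : α → ι → F} {θ A B S s₀ δ₀ : ℝ} {u₀ : α}

omit [CompleteSpace F] in
/-- **THE DISPLACEMENT ALONG THE ORBIT IS GEOMETRIC**: under the hypotheses of `iterate_invariant` and the displacement letter `‖ev (step u) i − ev u i‖ ≤ B·Df u` on the working region,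
`dist (ev(u_j) i) (ev(u_{j+1}) i) ≤ Bδ₀·θ^j`. [folklore] -/
theorem dist_orbit_succ_le (hθ0 : 0 ≤ θ) (hθ1 : θ < 1) (hA : 0 ≤ A) (hδ₀ : 0 ≤ δ₀) (hS : s₀ + A * δ₀ / (1 - θ) ≤ S)
    (hmaps : ∀ u ∈ K, ‖Φ u‖ ≤ S → step u ∈ K)
    (hcontr : ∀ u ∈ K, ‖Φ u‖ ≤ S → Df (step u) ≤ θ * Df u)
    (hgrow : ∀ u ∈ K, ‖Φ u‖ ≤ S → ‖Φ (step u)‖ ≤ ‖Φ u‖ + A * Df u)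
    (hB : 0 ≤ B) (hdisp : ∀ u ∈ K, ‖Φ u‖ ≤ S → ∀ i, ‖ev (step u) i - ev u i‖ ≤ B * Df u)
    (hu₀ : u₀ ∈ K) (hs₀ : ‖Φ u₀‖ ≤ s₀) (hd₀ : Df u₀ ≤ δ₀) (i : ι) (j : ℕ) :
    dist (ev (step^[j] u₀) i) (ev (step^[j + 1] u₀) i) ≤ B * δ₀ * θ ^ j := by
  obtain ⟨hK, hD, -⟩ := iterate_invariant hθ0 hθ1 hA hδ₀ hS hmaps hcontr hgrow hu₀ hs₀ hd₀ j
  have hN := iterate_norm_le hθ0 hθ1 hA hδ₀ hS hmaps hcontr hgrow hu₀ hs₀ hd₀ j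
  rw [dist_comm, dist_eq_norm, Function.iterate_succ_apply']
  calc ‖ev (step (step^[j] u₀)) i - ev (step^[j] u₀) i‖ ≤ B * Df (step^[j] u₀) := hdisp _ hK (hN.trans hS) i
    _ ≤ B * (θ ^ j * δ₀) := mul_le_mul_of_nonneg_left hD hB
    _ = B * δ₀ * θ ^ j := by ring

/-- **THE CAUCHY ENGINE**: under the hypotheses of `dist_orbit_succ_le`, every observed coordinate of the orbit converges, `ev(u_j) i → v i`, with the tail bound
`dist (ev(u_j) i) (v i) ≤ Bδ₀θ^j∕(1−θ)`; and along the orbit `u_j ∈ K`, `Df(u_j) ≤ θ^j·δ₀`, `‖Φ(u_j)‖ ≤ s₀ + Aδ₀∕(1−θ)`. [folklore] -/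
theorem exists_orbit_limit (hθ0 : 0 ≤ θ) (hθ1 : θ < 1) (hA : 0 ≤ A) (hδ₀ : 0 ≤ δ₀) (hS : s₀ + A * δ₀ / (1 - θ) ≤ S)
    (hmaps : ∀ u ∈ K, ‖Φ u‖ ≤ S → step u ∈ K)
    (hcontr : ∀ u ∈ K, ‖Φ u‖ ≤ S → Df (step u) ≤ θ * Df u)
    (hgrow : ∀ u ∈ K, ‖Φ u‖ ≤ S → ‖Φ (step u)‖ ≤ ‖Φ u‖ + A * Df u)
    (hB : 0 ≤ B) (hdisp : ∀ u ∈ K, ‖Φ u‖ ≤ S → ∀ i, ‖ev (step u) i - ev u i‖ ≤ B * Df u)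
    (hu₀ : u₀ ∈ K) (hs₀ : ‖Φ u₀‖ ≤ s₀) (hd₀ : Df u₀ ≤ δ₀) :
    ∃ v : ι → F, (∀ i, Tendsto (fun j => ev (step^[j] u₀) i) atTop (𝓝 (v i))) ∧
      (∀ (i : ι) (j : ℕ), dist (ev (step^[j] u₀) i) (v i) ≤ B * δ₀ * θ ^ j / (1 - θ)) ∧
      ∀ j, step^[j] u₀ ∈ K ∧ Df (step^[j] u₀) ≤ θ ^ j * δ₀ ∧ ‖Φ (step^[j] u₀)‖ ≤ s₀ + A * δ₀ / (1 - θ) := by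
  have hgeo := fun i => dist_orbit_succ_le hθ0 hθ1 hA hδ₀ hS hmaps hcontr hgrow hB hdisp hu₀ hs₀ hd₀ i
  have hlim : ∀ i, ∃ a, Tendsto (fun j => ev (step^[j] u₀) i) atTop (𝓝 a) := fun i =>
    cauchySeq_tendsto_of_complete (cauchySeq_of_le_geometric θ (B * δ₀) hθ1 (hgeo i))
  choose v hv using hlim
  refine ⟨v, hv, fun i j => dist_le_of_le_geometric_of_tendsto θ (B * δ₀) hθ1 (hgeo i) (hv i) j, fun j => ⟨?_, ?_, ?_⟩⟩
  · exact (iterate_invariant hθ0 hθ1 hA hδ₀ hS hmaps hcontr hgrow hu₀ hs₀ hd₀ j).1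
  · exact (iterate_invariant hθ0 hθ1 hA hδ₀ hS hmaps hcontr hgrow hu₀ hs₀ hd₀ j).2.1
  · exact iterate_norm_le hθ0 hθ1 hA hδ₀ hS hmaps hcontr hgrow hu₀ hs₀ hd₀ j

end Engine

/-! ## §2 The engine on the unitary periodic site gauges -/

section Gauge

open scoped Matrix.Norms.L2Operator
open Literature.MathematicalPhysics.QuantumFieldTheory.Balaban1983to89
open B7Prop1Explicit B7Prop2Explicit
open NE3EnergyShapes (IsUnitarySite IsPeriodicSite)

variable {d : ℕ} {n : Type*} [Fintype n] [DecidableEq n]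

/-- a sitewise limit of unitary gauges is unitary (the unitary group is closed). [folklore] -/
theorem mem_unitary_of_tendsto {u : ℕ → Site d → (Matrix n n ℂ)ˣ} (hu : ∀ j, IsUnitarySite (u j)) {v : Site d → Matrix n n ℂ}
    (hv : ∀ x, Tendsto (fun j => ((u j x : (Matrix n n ℂ)ˣ) : Matrix n n ℂ)) atTop (𝓝 (v x))) (x : Site d) :
    v x ∈ unitary (Matrix n n ℂ) := by
  rw [Unitary.mem_iff]
  have h1 : Tendsto (fun j => star ((u j x : (Matrix n n ℂ)ˣ) : Matrix n n ℂ) * ((u j x : (Matrix n n ℂ)ˣ) : Matrix n n ℂ)) atTop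
      (𝓝 (star (v x) * v x)) := (hv x).star.mul (hv x)
  have h2 : Tendsto (fun j => ((u j x : (Matrix n n ℂ)ˣ) : Matrix n n ℂ) * star ((u j x : (Matrix n n ℂ)ˣ) : Matrix n n ℂ)) atTop
      (𝓝 (v x * star (v x))) := (hv x).mul (hv x).star
  have e1 : (fun j => star ((u j x : (Matrix n n ℂ)ˣ) : Matrix n n ℂ) * ((u j x : (Matrix n n ℂ)ˣ) : Matrix n n ℂ)) = fun _ => 1 :=
    funext fun j => Unitary.star_mul_self_of_mem (mem_unitaryUnits.mp (hu j x))
  have e2 : (fun j => ((u j x : (Matrix n n ℂ)ˣ) : Matrix n n ℂ) * star ((u j x : (Matrix n n ℂ)ˣ) : Matrix n n ℂ)) = fun _ => 1 :=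
    funext fun j => Unitary.mul_star_self_of_mem (mem_unitaryUnits.mp (hu j x))
  rw [e1] at h1
  rw [e2] at h2
  exact ⟨tendsto_nhds_unique h1 tendsto_const_nhds, tendsto_nhds_unique h2 tendsto_const_nhds⟩

/-- a sitewise limit of `P`-periodic gauges is `P`-periodic. [folklore] -/
theorem periodic_of_tendsto {u : ℕ → Site d → (Matrix n n ℂ)ˣ} {P : ℤ} (hu : ∀ j, IsPeriodicSite (u j) P) {v : Site d → Matrix n n ℂ}
    (hv : ∀ x, Tendsto (fun j => ((u j x : (Matrix n n ℂ)ˣ) : Matrix n n ℂ)) atTop (𝓝 (v x))) (x : Site d) (i : Fin d) :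
    v (x + P • e i) = v x := by
  have h : (fun j => ((u j (x + P • e i) : (Matrix n n ℂ)ˣ) : Matrix n n ℂ)) = fun j => ((u j x : (Matrix n n ℂ)ˣ) : Matrix n n ℂ) :=
    funext fun j => by rw [hu j x i]
  have h1 := hv (x + P • e i)
  rw [h] at h1
  exact tendsto_nhds_unique h1 (hv x)

/-- **THE (S1) ENGINE ON THE GAUGE GROUP, CAUCHY FORM**: `K` = unitary `P`-periodic site gauges; a size `Φ` (any seminormed values), a defect `Df`, a step that keeps `K`, contracts `Df` by
`θ ∈ [0,1)`, moves `‖Φ‖` by `≤ A·Df` and DISPLACES EACH SITE VALUE by `≤ B·Df` on the working region `{‖Φ‖ ≤ S}`, `s₀ + Aδ₀∕(1−θ) ≤ S`; a datum `u₀ ∈ K` with `‖Φ u₀‖ ≤ s₀`, `Df u₀ ≤ δ₀`.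
THEN there is a unitary `P`-periodic `u_*` with `u_j(x) → u_*(x)` at every site (`u_j := step^[j] u₀`), `‖u_j(x) − u_*(x)‖ ≤ Bδ₀θ^j∕(1−θ)`, and along the orbit `u_j ∈ K`,
`Df(u_j) ≤ θ^jδ₀`, `‖Φ(u_j)‖ ≤ s₀ + Aδ₀∕(1−θ)`. [folklore] -/
theorem exists_limit_gauge {E : Type*} [SeminormedAddCommGroup E] {P : ℤ}
    {step : (Site d → (Matrix n n ℂ)ˣ) → (Site d → (Matrix n n ℂ)ˣ)} {Φ : (Site d → (Matrix n n ℂ)ˣ) → E} {Df : (Site d → (Matrix n n ℂ)ˣ) → ℝ}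
    {θ A B S s₀ δ₀ : ℝ} {u₀ : Site d → (Matrix n n ℂ)ˣ}
    (hθ0 : 0 ≤ θ) (hθ1 : θ < 1) (hA : 0 ≤ A) (hδ₀ : 0 ≤ δ₀) (hS : s₀ + A * δ₀ / (1 - θ) ≤ S) (hB : 0 ≤ B)
    (hmaps : ∀ u : Site d → (Matrix n n ℂ)ˣ, IsUnitarySite u → IsPeriodicSite u P → ‖Φ u‖ ≤ S → IsUnitarySite (step u) ∧ IsPeriodicSite (step u) P)
    (hcontr : ∀ u : Site d → (Matrix n n ℂ)ˣ, IsUnitarySite u → IsPeriodicSite u P → ‖Φ u‖ ≤ S → Df (step u) ≤ θ * Df u)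
    (hgrow : ∀ u : Site d → (Matrix n n ℂ)ˣ, IsUnitarySite u → IsPeriodicSite u P → ‖Φ u‖ ≤ S → ‖Φ (step u)‖ ≤ ‖Φ u‖ + A * Df u)
    (hdisp : ∀ u : Site d → (Matrix n n ℂ)ˣ, IsUnitarySite u → IsPeriodicSite u P → ‖Φ u‖ ≤ S →
      ∀ x, ‖((step u x : (Matrix n n ℂ)ˣ) : Matrix n n ℂ) - ((u x : (Matrix n n ℂ)ˣ) : Matrix n n ℂ)‖ ≤ B * Df u)
    (hu₀ : IsUnitarySite u₀) (hu₀P : IsPeriodicSite u₀ P) (hs₀ : ‖Φ u₀‖ ≤ s₀) (hd₀ : Df u₀ ≤ δ₀) :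
    ∃ ustar : Site d → (Matrix n n ℂ)ˣ, IsUnitarySite ustar ∧ IsPeriodicSite ustar P ∧
      (∀ x, Tendsto (fun j => ((step^[j] u₀ x : (Matrix n n ℂ)ˣ) : Matrix n n ℂ)) atTop (𝓝 ((ustar x : (Matrix n n ℂ)ˣ) : Matrix n n ℂ))) ∧
      (∀ (x : Site d) (j : ℕ), ‖((step^[j] u₀ x : (Matrix n n ℂ)ˣ) : Matrix n n ℂ) - ((ustar x : (Matrix n n ℂ)ˣ) : Matrix n n ℂ)‖ ≤ B * δ₀ * θ ^ j / (1 - θ)) ∧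
      ∀ j, IsUnitarySite (step^[j] u₀) ∧ IsPeriodicSite (step^[j] u₀) P ∧ Df (step^[j] u₀) ≤ θ ^ j * δ₀ ∧ ‖Φ (step^[j] u₀)‖ ≤ s₀ + A * δ₀ / (1 - θ) := by
  obtain ⟨v, hv, htail, horbit⟩ := exists_orbit_limit (K := {u | IsUnitarySite u ∧ IsPeriodicSite u P})
    (ev := fun (u : Site d → (Matrix n n ℂ)ˣ) (x : Site d) => ((u x : (Matrix n n ℂ)ˣ) : Matrix n n ℂ))
    hθ0 hθ1 hA hδ₀ hS (fun u hu hS' => hmaps u hu.1 hu.2 hS') (fun u hu hS' => hcontr u hu.1 hu.2 hS') (fun u hu hS' => hgrow u hu.1 hu.2 hS')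
    hB (fun u hu hS' => hdisp u hu.1 hu.2 hS') ⟨hu₀, hu₀P⟩ hs₀ hd₀
  have hvu : ∀ x, v x ∈ unitary (Matrix n n ℂ) := mem_unitary_of_tendsto (fun j => (horbit j).1.1) hv
  refine ⟨fun x => Unitary.toUnits ⟨v x, hvu x⟩, fun x => ?_, fun x i => ?_, fun x => hv x, fun x j => ?_, fun j => ⟨(horbit j).1.1, (horbit j).1.2, (horbit j).2⟩⟩
  · exact mem_unitaryUnits.mpr (hvu x)
  · exact Units.ext (periodic_of_tendsto (fun j => (horbit j).1.2) hv x i)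
  · have h := htail x j
    rwa [dist_eq_norm] at h

end Gauge

end Summit.QuantumFields.BalabanUV.T4Continuum.NE7DefectIterationCauchy
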